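
import Summits.AnomalousDissipation.AnomalousDissipation.Theses.SteadyMirrorGate

/-!
# Candidate proof of the glue item stmt-AnomalousDissipation-27869 `SteadyMirrorGate.MirrorEnstrophyGapTGGlue`
(U_G → R → G; route-AnomalousDissipation-SteadyMirrorGate rev4 2acb690b48f7, tree Theses/SteadyMirrorGate.lean 8ff629514a1b).
READY TO LAND by any prover (planners do not propose Theorems):
  `ledger propose --kind proof --target Summits/AnomalousDissipation/AnomalousDissipation/Theorems/SteadyMirrorGateMirrorEnstrophyGapTGGlue.lean
     --file <this file> --workitem stmt-AnomalousDissipation-27869`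
Proof = lens-6 g21 StretchingGate kernel (HOME/decomp-ad-lens-6/g21/StretchingGate.lean 5a56014504a1) theorem
`gap_of_tameOrUnstrained_of_unstrainedTame`, re-keyed onto the TREE decls (bodies byte-identical): pure logic — given E take
η from R, feed σ := η to U_G, M := max, ε := min. Writer decomp-ad-writer-1 g8.
-/

set_option linter.dupNamespace false

namespace Summit.AnomalousDissipation.AnomalousDissipation.Theorems

open Summit.AnomalousDissipation.AnomalousDissipation.Theses.SteadyMirrorGate

/-- U_G ∧ R ⇒ G over the tree decls (the reassembly of the exact effective-strain cut of stmt-33831). -/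
theorem steadyMirrorGate_gap_of_tameOrUnstrained_of_unstrainedTame (hUG : MirrorTameOrUnstrainedTG)
    (hR : MirrorUnstrainedTameTG) : MirrorEnstrophyGapTG := by
  intro f hf E
  obtain ⟨M, ε₁, η, hε₁, hη, hR'⟩ := hR f hf E
  obtain ⟨M', ε₂, hε₂, hUG'⟩ := hUG f hf E η hη
  refine ⟨max M M', min ε₁ ε₂, lt_min hε₁ hε₂, fun ν hν u hV hsol heq hK hEn => ?_⟩
  by_cases hq : min ε₁ ε₂ ≤ ν * (Literature.Analysis.FunctionSpaces.Torus.eGradNormSq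
      ((u : MeasureTheory.Lp (EuclideanSpace ℝ (Fin 3)) 2 (MeasureTheory.volume : MeasureTheory.Measure (UnitAddTorus (Fin 3)))) : UnitAddTorus (Fin 3) → EuclideanSpace ℝ (Fin 3))).toReal
  · exact Or.inr hq
  · left
    rw [not_le] at hq
    have h1 := lt_of_lt_of_le hq (min_le_left _ _)
    have h2 := lt_of_lt_of_le hq (min_le_right _ _)
    rcases hUG' ν hν u hV hsol heq hK hEn h2 with h | h
    · exact h.trans (ENNReal.ofReal_le_ofReal (le_max_right _ _))
    · exact (hR' ν hν u hV hsol heq hK hEn h1 h).trans (ENNReal.ofReal_le_ofReal (le_max_left _ _))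

/-- THE GLUE ITEM stmt-AnomalousDissipation-27869, by name. -/
theorem steadyMirrorGate_mirrorEnstrophyGapTGGlue_holds : MirrorEnstrophyGapTGGlue :=
  steadyMirrorGate_gap_of_tameOrUnstrained_of_unstrainedTame

end Summit.AnomalousDissipation.AnomalousDissipation.Theorems
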